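import Literature.AlgebraicGeometry.ModuliOfAbelianVarieties.SiegelAdelicCongrTransport
import HarnessLib

/-!
# Level-`N` readings of marked complex abelian varieties agree under a `K_δ(N)`-compatible homomorphism
# ([Milne 2005] Thm. 6.11 «…sending `ηK` to `η′K`»; [Deligne 1971] 4.16 «classe mod `K_n`»)

Topic `AlgebraicGeometry/ModuliOfAbelianVarieties`; namespace `Literature.AlgebraicGeometry.ModuliOfAbelianVarieties.SiegelAdelicMarking`.
Cell hodgecm-mathlib (D-0151), rung-0 ladder / M1PRIME-DAG W3 (stub prover B-p01): the «level clause» feeder of the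
triple transport.  In the ★ `SiegelRationalModel.IsModuli` antecedent a homomorphism `f : A ⟶ A′` of T1′-MARKED complex
abelian varieties carries `u(v)` to `u′(w)` whenever `k a⁻¹ v̂ ≡ a′⁻¹ ŵ (mod ℤ̂^{2g})` for a FIXED `k ∈ K_δ(N)`; a
LEVEL-`N` READING of a point `x ∈ A(ℂ)` at a class `c ∈ N⁻¹ℤ^{2g}` is the rule «`x = u(v)` whenever `a⁻¹ v̂ ≡ ĉ`» (this is
how the rung-0 texts read the level sections `σᵢ(𝟙)` of a triple over `Spec ℂ`: the symplectic-lift tower of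
[D3 `SymplecticLift`] at `M = N`, (U)'s `IsAdmissibleAt` / the skeleton's `MarkedBy`).  THEN `f` carries the reading of
`A` at `c` to the reading of `A′` at `c` — because `k ≡ 1 (mod N)` acts trivially on `N⁻¹Λ` (★ R60-58
`adelicCongr_coe_mul_inv_iff_of_mem_principalLevelSubgroup`).  THEOREMS ONLY (no definition, no named fact, no instance,
no `sorry`); everything in ★ T1′ / ★ R60-58 currency.  HC_CM is proved only modulo the printed citations until rung 0 closes.

## References
* [Milne2005ShimuraVarieties] J. S. Milne, *Introduction to Shimura varieties* (2005), §6 Thm. 6.11 p. 74 and p. 75 (`ηK`),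
  §4 pp. 48–49 (lattices `ℚ^{2g} ∩ a ẑ^{2g}`).
* [Deligne1971TravauxShimura] P. Deligne, *Travaux de Shimura*, Sém. Bourbaki 389 (1971), 4.16 p. 150 («classe mod `K_n`»).
-/

set_option autoImplicit false

noncomputable section

namespace Literature.AlgebraicGeometry.ModuliOfAbelianVarieties

namespace SiegelAdelicMarking

open Matrix CategoryTheory
open Literature.AlgebraicGeometry.Motives (AbelianVariety AlgPoints)
open Literature.NumberTheory.Adeles (latticeOfGL mem_latticeOfGL_one_iff)

variable {g : ℕ} {δ : Fin g → ℕ}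
variable {J J' : C0pm δ} {a a' k : gspFinAdelic δ} {A A' : AbelianVariety ℂ}

/-- **Readings at a class `c` are `K_δ(N)`-transported**: if `a⁻¹ v̂ ≡ ĉ` and `k a⁻¹ v̂ ≡ a′⁻¹ ŵ` with `k ∈ K_δ(N)` and
`N c ∈ ℤ^{2g}`, then `a′⁻¹ ŵ ≡ ĉ` (`k ≡ 1 mod N` acts trivially on `N⁻¹Λ_a`).
[cite: Milne2005ShimuraVarieties, §6 Thm. 6.11 p. 74 and p. 75] [cite: Deligne1971TravauxShimura, 4.16 p. 150] -/
theorem adelicCongr_inv_one_of_level {N : ℕ} (hk : k ∈ principalLevelSubgroup δ N)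
    {c v w : Fin g ⊕ Fin g → ℚ} (hc : N • c ∈ latticeOfGL (1 : GL (Fin g ⊕ Fin g) finAdeleQ))
    (hv : AdelicCongr ((a⁻¹ : gspFinAdelic δ) : GL (Fin g ⊕ Fin g) finAdeleQ) 1 v c)
    (hvw : AdelicCongr ((k * a⁻¹ : gspFinAdelic δ) : GL (Fin g ⊕ Fin g) finAdeleQ)
      ((a'⁻¹ : gspFinAdelic δ) : GL (Fin g ⊕ Fin g) finAdeleQ) v w) :
    AdelicCongr ((a'⁻¹ : gspFinAdelic δ) : GL (Fin g ⊕ Fin g) finAdeleQ) 1 w c := by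
  -- `N v ∈ Λ_a` from `a⁻¹ v̂ ≡ ĉ` and `N c ∈ ℤ^{2g}`
  have hNv : N • v ∈ latticeOfGL (a : GL (Fin g ⊕ Fin g) finAdeleQ) := by
    have h := (hv.nsmul N).mem_latticeOfGL_iff.2 (by rwa [inv_one])
    rwa [latticeOfGL_inv_coe_inv_eq] at h
  -- drop `k` (★ R60-58), then compose `w ~ v ~ c`
  have hvw' : AdelicCongr ((a⁻¹ : gspFinAdelic δ) : GL (Fin g ⊕ Fin g) finAdeleQ)
      ((a'⁻¹ : gspFinAdelic δ) : GL (Fin g ⊕ Fin g) finAdeleQ) v w :=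
    (adelicCongr_coe_mul_inv_iff_of_mem_principalLevelSubgroup hk hNv).1 hvw
  exact (adelicCongr_comm.1 hvw').trans hv

/-- **A `K_δ(N)`-compatible homomorphism of marked varieties carries level-`N` readings to level-`N` readings**: for
`f : A ⟶ A′` with `f (u v) = u′ w` whenever `k a⁻¹ v̂ ≡ a′⁻¹ ŵ` (`k ∈ K_δ(N)` fixed — the ★ `SiegelRationalModel.IsModuli`
antecedent at `σ = 1`), a class `c` with `N c ∈ ℤ^{2g}`, and points `x ∈ A(ℂ)`, `x′ ∈ A′(ℂ)` READ at `c` through the two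
markings (`x = u v` whenever `a⁻¹ v̂ ≡ ĉ`, `x′ = u′ w` whenever `a′⁻¹ ŵ ≡ ĉ`), one has `f x = x′`.  (With `x, x′` the values at
`𝟙` of the `i`-th level sections and `c = eᵢ/N` this is «`f` sends `η_a K` to `η_{a′} K`» on the chosen bases.)
[cite: Milne2005ShimuraVarieties, §6 Thm. 6.11 p. 74 and p. 75] [cite: Deligne1971TravauxShimura, 4.16 p. 150] -/
theorem map_eq_of_levelReading (m : SiegelAdelicMarking J a A) (m' : SiegelAdelicMarking J' a' A') (f : A ⟶ A')
    {N : ℕ} (hk : k ∈ principalLevelSubgroup δ N)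
    (hf : ∀ v w : Fin g ⊕ Fin g → ℚ,
      AdelicCongr ((k * a⁻¹ : gspFinAdelic δ) : GL (Fin g ⊕ Fin g) finAdeleQ)
          ((a'⁻¹ : gspFinAdelic δ) : GL (Fin g ⊕ Fin g) finAdeleQ) v w →
        AlgPoints.map f.hom.hom.hom (m.r v) = m'.r w)
    {c : Fin g ⊕ Fin g → ℚ} (hc : N • c ∈ latticeOfGL (1 : GL (Fin g ⊕ Fin g) finAdeleQ))
    {x : A.Points ℂ} {x' : A'.Points ℂ}
    (hx : ∀ v, AdelicCongr ((a⁻¹ : gspFinAdelic δ) : GL (Fin g ⊕ Fin g) finAdeleQ) 1 v c → x = m.r v)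
    (hx' : ∀ w, AdelicCongr ((a'⁻¹ : gspFinAdelic δ) : GL (Fin g ⊕ Fin g) finAdeleQ) 1 w c → x' = m'.r w) :
    AlgPoints.map f.hom.hom.hom x = x' := by
  obtain ⟨v, hv⟩ := exists_adelicCongr_left ((a⁻¹ : gspFinAdelic δ) : GL (Fin g ⊕ Fin g) finAdeleQ) 1 c
  obtain ⟨w, hvw⟩ := exists_adelicCongr_right ((k * a⁻¹ : gspFinAdelic δ) : GL (Fin g ⊕ Fin g) finAdeleQ)
    ((a'⁻¹ : gspFinAdelic δ) : GL (Fin g ⊕ Fin g) finAdeleQ) v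
  rw [hx v hv, hf v w hvw, hx' w (adelicCongr_inv_one_of_level hk hc hv hvw)]

/-- The classes read by the rung-0 texts: for `x : (ℤ/N)^{2g}` the rational lift `c = (x̃ᵢ / N)ᵢ` has `N c ∈ ℤ^{2g}`.
[cite: Milne2005ShimuraVarieties, §6 p. 75] -/
theorem nsmul_val_div_mem_latticeOfGL_one {N : ℕ} (hN : N ≠ 0) (x : Fin g ⊕ Fin g → ZMod N) :
    N • (fun i => ((x i).val : ℚ) / N) ∈ latticeOfGL (1 : GL (Fin g ⊕ Fin g) finAdeleQ) := by
  refine mem_latticeOfGL_one_iff.2 fun i => ⟨((x i).val : ℤ), ?_⟩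
  have hN' : (N : ℚ) ≠ 0 := Nat.cast_ne_zero.2 hN
  simp [Pi.smul_apply, nsmul_eq_mul, mul_div_cancel₀ _ hN']

/-- **Level-`N` readings at the tower classes**: `map_eq_of_levelReading` at `c = x̃/N`, `x : (ℤ/N)^{2g}` — the shape in which
D3's `SymplecticLift` tower (at `M = N`, with `lift_level`) and the rung-0 predicates `IsAdmissibleAt` / `MarkedBy` read the
level sections. [cite: Milne2005ShimuraVarieties, §6 Thm. 6.11 p. 74 and p. 75] [cite: Deligne1971TravauxShimura, 4.16 p. 150] -/
theorem map_eq_of_levelReading_val (m : SiegelAdelicMarking J a A) (m' : SiegelAdelicMarking J' a' A') (f : A ⟶ A')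
    {N : ℕ} (hN : N ≠ 0) (hk : k ∈ principalLevelSubgroup δ N)
    (hf : ∀ v w : Fin g ⊕ Fin g → ℚ,
      AdelicCongr ((k * a⁻¹ : gspFinAdelic δ) : GL (Fin g ⊕ Fin g) finAdeleQ)
          ((a'⁻¹ : gspFinAdelic δ) : GL (Fin g ⊕ Fin g) finAdeleQ) v w →
        AlgPoints.map f.hom.hom.hom (m.r v) = m'.r w)
    (x : Fin g ⊕ Fin g → ZMod N) {y : A.Points ℂ} {y' : A'.Points ℂ}
    (hy : ∀ v, AdelicCongr ((a⁻¹ : gspFinAdelic δ) : GL (Fin g ⊕ Fin g) finAdeleQ) 1 v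
      (fun i => ((x i).val : ℚ) / N) → y = m.r v)
    (hy' : ∀ w, AdelicCongr ((a'⁻¹ : gspFinAdelic δ) : GL (Fin g ⊕ Fin g) finAdeleQ) 1 w
      (fun i => ((x i).val : ℚ) / N) → y' = m'.r w) :
    AlgPoints.map f.hom.hom.hom y = y' :=
  map_eq_of_levelReading m m' f hk hf (nsmul_val_div_mem_latticeOfGL_one hN x) hy hy'

end SiegelAdelicMarking

end Literature.AlgebraicGeometry.ModuliOfAbelianVarieties

end
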